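import Mathlib
import HarnessLib
import Literature.Analysis.FluidPDE.TypeIAncientMild
import Literature.Analysis.FluidPDE.LocalTypeIReverseTools
import Literature.Analysis.FluidPDE.LocalTypeIPersistenceHolds
import Literature.Analysis.FluidPDE.LocalTypeIProofs
import Literature.Analysis.FluidPDE.LocalTypeIScaling
import Summits.NavierStokesRegularity.NavierStokesRegularity.Theorems.SqueezeCycleExtremalElementExistsRescale
import Summits.NavierStokesRegularity.NavierStokesRegularity.Theorems.SqueezeCycleExtremalElementExistsExtraction
import Summits.NavierStokesRegularity.NavierStokesRegularity.Theorems.SymmetryModuliCountAxisymEndLiouvilleOfFarPastLedgerDriver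

/-!
# Route SymmetryModuliCount — crux `ForcedSymmetry` (stmt-NavierStokesRegularity-4052),
# line `blow-down-census`: the general blow-down DRIVER

Theorems file serving the registered stub `stub_blowDownDriver` of the skeleton line
`blow-down-census` for the crux item
`Summit.NavierStokesRegularity.NavierStokesRegularity.Theses.SymmetryModuliCount.ForcedSymmetry`.

It is the landed 𝒦-route driver
`AxisymEndLiouvilleOfFarPastLedger.exists_singular_axisymmetric_limit`
(`Theorems/SymmetryModuliCountAxisymEndLiouvilleOfFarPastLedgerDriver.lean`) with the symmetry
transport deleted and the `C¹_loc`-limit in the Type-I ancient mild class `A_C` added: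

* an element `v ∈ A_C` (`IsTypeIAncientMild C v`) with the Leray-rate ledger `K` and
  `v(t₀, x₀) ≠ 0`, `t₀ < 0`, is blown down about the centre `(t₁, x₁) = (t₀/2, x₀)` at the
  scales `c_k = k + 1 + √(−t₁) → ∞`: the blow-downs `V_k = c_k v(t₁ + c_k² ·, x₁ + c_k ·)` are
  backward shifts by `T_k = −t₁/c_k² ∈ (0, 1]` of the zooms `c_k v(c_k² ·, x₁ + c_k ·) ∈ A_C`
  (`isTypeIAncientMild_zoom`, ledger by `scaledEnergy_zoom`), hence lie in `A_C`
  (`IsTypeIAncientMild.comp_sub_right`) and — by the two class hypotheses `hcubic`, `hPress`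
  (uniform cubic bound, pressure package) — in Albritton–Barker's class 𝒦 uniformly;
* `SuitableCompactness_holds` (A–B Lemma 2.2) extracts an `L³_loc` suitable weak limit `U` along
  `σ`, SINGULAR at the origin by `PersistenceOfSingularities_holds` (A–B Prop. 2.3) since
  `‖V_k‖_{L∞(Q(0,R))} → ∞` (`tendsto_eLpNorm_top_zoom_atTop`);
* `exists_tendsto_of_isTypeIAncientMild_seq` (KNSS 2009 Lemma 6.1 / Prop. 4.1) extracts along a
  further subsequence `φ` a slice-wise pointwise and locally uniform limit `W ∈ A_C`;
* `U = W` a.e. on `Q(0, ½)`: the `L³` convergence gives convergence in measure, an a.e.-convergent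
  subsequence, and uniqueness of limits at every point of the open lower half-space.

## References

* D. Albritton, T. Barker, J. Math. Fluid Mech. 21 (2019) = arXiv:1811.00502, Lemma 2.2,
  Prop. 2.3, §3. [AlbrittonBarker2019]
* G. Koch, N. Nadirashvili, G. Seregin, V. Šverák, Acta Math. 203 (2009), Lemma 6.1, Prop. 4.1.
  [KochNadirashviliSereginSverak2009]
-/

noncomputable section

-- the summit and its single problem share the name (D-0017 nested layout)
set_option linter.dupNamespace false

open MeasureTheory Set Metric Filter Function TopologicalSpace
open scoped ENNReal NNReal Topology

namespace Summit.NavierStokesRegularity.NavierStokesRegularity.Theorems.ForcedSymmetry.BlowDownCensus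

open Literature.Analysis.FluidPDE
open Summit.NavierStokesRegularity.NavierStokesRegularity.Theorems
open Summit.NavierStokesRegularity.NavierStokesRegularity.Theorems.AxisymEndLiouvilleOfFarPastLedger

/-- **The general blow-down DRIVER** of the line `blow-down-census` (the landed
`AxisymEndLiouvilleOfFarPastLedger.exists_singular_axisymmetric_limit` with the symmetry transport
deleted and the `A_C`-limit added). Inputs: the uniform cubic bound and the pressure package for
the class `A_C ∩ {ledger K}` (hypotheses), an element `v` with ledger `K` and `v(t₀,x₀) ≠ 0`,
`t₀ < 0`. Output: a centre `(t₁,x₁)`, `t₁ < 0`, scales `c_k > 0`, `c_k → ∞` (already passed to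
the subsequence), the `L³_loc` suitable weak limit `U` of the blow-downs
`c_k v(t₁ + c_k² s, x₁ + c_k y)` in `Q(0,1)` — SINGULAR at the origin by
`SuitableCompactness_holds` + `PersistenceOfSingularities_holds` (A–B Lemma 2.2, Prop 2.3) fed by
`tendsto_eLpNorm_top_zoom_atTop` — and their slice-wise pointwise and locally uniform limit
`W ∈ A_C` (`exists_tendsto_of_isTypeIAncientMild_seq` applied to the blow-downs, which lie in
`A_C` by `isTypeIAncientMild_zoom` + `comp_sub_right`), identified with `U` a.e. on `Q(0,½)`
(an a.e.-convergent subsequence of the `L³` convergence).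
[cite: AlbrittonBarker2019, Lemma 2.2, Prop. 2.3 and §3] -/
theorem stub_blowDownDriver :
    ∀ (C K D₀ : ℝ),
    (∀ w : ℝ → EuclideanSpace ℝ (Fin 3) → EuclideanSpace ℝ (Fin 3), IsTypeIAncientMild C w →
      (∀ t < 0, ∀ (x₀ : EuclideanSpace ℝ (Fin 3)) (R : ℝ), 0 < R →
        ∫ x in ball x₀ R, ‖w t x‖ ^ 2 ≤ K * R) →
      ∫⁻ z in parabolicCylinder 1 (0 : ℝ × EuclideanSpace ℝ (Fin 3)), ‖w z.1 z.2‖ₑ ^ (3 : ℕ) ≤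
        ENNReal.ofReal (2 * C * K)) →
    (∀ w : ℝ → EuclideanSpace ℝ (Fin 3) → EuclideanSpace ℝ (Fin 3), IsTypeIAncientMild C w →
      (∀ t < 0, ∀ (x₀ : EuclideanSpace ℝ (Fin 3)) (R : ℝ), 0 < R →
        ∫ x in ball x₀ R, ‖w t x‖ ^ 2 ≤ K * R) →
      ∀ T ∈ Ioc (0 : ℝ) 1, ∃ q : ℝ → EuclideanSpace ℝ (Fin 3) → ℝ,
        IsSuitableWeakSolutionInBall 1 0 (fun s y => w (s - T) y) q ∧
        ∫⁻ z in parabolicCylinder 1 (0 : ℝ × EuclideanSpace ℝ (Fin 3)), ‖q z.1 z.2‖ₑ ^ (3 / 2 : ℝ) ≤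
          ENNReal.ofReal D₀) →
    ∀ (v : ℝ → EuclideanSpace ℝ (Fin 3) → EuclideanSpace ℝ (Fin 3)), IsTypeIAncientMild C v →
      (∀ t < 0, ∀ (x₀ : EuclideanSpace ℝ (Fin 3)) (R : ℝ), 0 < R →
        ∫ x in ball x₀ R, ‖v t x‖ ^ 2 ≤ K * R) →
      ∀ (t₀ : ℝ) (x₀ : EuclideanSpace ℝ (Fin 3)), t₀ < 0 → v t₀ x₀ ≠ 0 →
      ∃ (t₁ : ℝ) (x₁ : EuclideanSpace ℝ (Fin 3)) (c : ℕ → ℝ)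
        (U W : ℝ → EuclideanSpace ℝ (Fin 3) → EuclideanSpace ℝ (Fin 3)),
        t₁ < 0 ∧ (∀ k, 0 < c k) ∧ Tendsto c atTop atTop ∧ IsTypeIAncientMild C W ∧
        (∀ s < 0, ∀ y, Tendsto (fun k => c k • v (t₁ + c k ^ 2 * s) (x₁ + c k • y)) atTop (𝓝 (W s y))) ∧
        (∀ s < 0, TendstoLocallyUniformly
          (fun k (y : EuclideanSpace ℝ (Fin 3)) => c k • v (t₁ + c k ^ 2 * s) (x₁ + c k • y)) (W s) atTop) ∧
        IsBackwardSingularPoint U 0 ∧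
        uncurry U =ᵐ[volume.restrict (parabolicCylinder (1 / 2) (0 : ℝ × EuclideanSpace ℝ (Fin 3)))]
          uncurry W := by
  intro C K D₀ hcubic hPress v hv hKv t₀ x₀ ht₀ hne
  -- ### the centre `(t₁, x₀)`, the radius, the scales
  set t₁ : ℝ := t₀ / 2 with ht₁
  have ht₁0 : t₁ < 0 := by rw [ht₁]; linarith
  have ht₀₁ : t₀ < t₁ := by rw [ht₁]; linarith
  set z₁ : ℝ × EuclideanSpace ℝ (Fin 3) := (t₁, x₀) with hz₁
  set ρ : ℝ := Real.sqrt (t₁ - t₀) + 1 with hρ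
  have hρ0 : 0 < ρ := by positivity
  have hz₀ : ((t₀, x₀) : ℝ × EuclideanSpace ℝ (Fin 3)) ∈ parabolicCylinder ρ z₁ := by
    rw [mem_parabolicCylinder]
    refine ⟨⟨?_, ht₀₁⟩, ?_⟩
    · show t₁ - ρ ^ 2 < t₀
      have h1 : Real.sqrt (t₁ - t₀) ^ 2 = t₁ - t₀ := Real.sq_sqrt (by linarith)
      have h2 : Real.sqrt (t₁ - t₀) < ρ := by rw [hρ]; linarith
      have h3 : Real.sqrt (t₁ - t₀) ^ 2 < ρ ^ 2 := pow_lt_pow_left₀ h2 (Real.sqrt_nonneg _) two_ne_zero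
      linarith
    · show dist x₀ x₀ < ρ
      rw [dist_self]
      exact hρ0
  -- `‖v‖_{L∞(Q(z₁, ρ))} ≠ 0`
  have hQO : parabolicCylinder ρ z₁ ⊆ Iio (0 : ℝ) ×ˢ (univ : Set (EuclideanSpace ℝ (Fin 3))) :=
    parabolicCylinder_subset_lowerHalf ht₁0.le ρ
  have hN : eLpNorm (uncurry v) ∞ (volume.restrict (parabolicCylinder ρ z₁)) ≠ 0 :=
    eLpNorm_top_ne_zero_of_continuousOn hv.continuousOn_uncurry hQO hz₀ hne
  set c : ℕ → ℝ := fun k => (k : ℝ) + 1 + Real.sqrt (-t₁) with hc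
  have hcpos : ∀ k, 0 < c k := fun k => by simp only [hc]; positivity
  have hctop : Tendsto c atTop atTop := by
    simp only [hc]
    refine tendsto_atTop_add_const_right _ _ ?_
    exact tendsto_atTop_add_const_right _ _ tendsto_natCast_atTop_atTop
  have hcsq : ∀ k, -t₁ ≤ c k ^ 2 := fun k => by
    have h1 : Real.sqrt (-t₁) ≤ c k := by
      simp only [hc]; linarith [Nat.cast_nonneg (α := ℝ) k]
    calc -t₁ = Real.sqrt (-t₁) ^ 2 := (Real.sq_sqrt (by linarith)).symm
      _ ≤ c k ^ 2 := pow_le_pow_left₀ (Real.sqrt_nonneg _) h1 2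
  set T : ℕ → ℝ := fun k => -t₁ / c k ^ 2 with hT
  have hT0 : ∀ k, 0 < T k := fun k => div_pos (by linarith) (pow_pos (hcpos k) 2)
  have hT1 : ∀ k, T k ≤ 1 := fun k => (div_le_one (pow_pos (hcpos k) 2)).2 (hcsq k)
  -- ### the zooms `w_k ∈ A_C` and their ledger
  set w : ℕ → ℝ → EuclideanSpace ℝ (Fin 3) → EuclideanSpace ℝ (Fin 3) :=
    fun k => (c k) • stPull (c k ^ 2) (c k) 0 x₀ v with hw
  have hwA : ∀ k, IsTypeIAncientMild C (w k) := fun k => isTypeIAncientMild_zoom hv (hcpos k) x₀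
  have hKw : ∀ k, ∀ t < 0, ∀ (y₀ : EuclideanSpace ℝ (Fin 3)) (R : ℝ), 0 < R →
      ∫ y in ball y₀ R, ‖w k t y‖ ^ 2 ≤ K * R := by
    intro k t ht y₀ R hR
    have h1 := scaledEnergy_zoom (hcpos k) x₀ y₀ v t hR
    have hct : c k ^ 2 * t < 0 := mul_neg_of_pos_of_neg (pow_pos (hcpos k) 2) ht
    have hcR : 0 < c k * R := mul_pos (hcpos k) hR
    have h2 : ∫ x in ball (x₀ + c k • y₀) (c k * R), ‖v (c k ^ 2 * t) x‖ ^ 2 ≤ K * (c k * R) :=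
      hKv _ hct _ _ hcR
    have h3 : R⁻¹ * ∫ y in ball y₀ R, ‖w k t y‖ ^ 2 ≤ K := by
      rw [hw, h1]
      calc (c k * R)⁻¹ * ∫ x in ball (x₀ + c k • y₀) (c k * R), ‖v (c k ^ 2 * t) x‖ ^ 2
          ≤ (c k * R)⁻¹ * (K * (c k * R)) := mul_le_mul_of_nonneg_left h2 (inv_nonneg.2 hcR.le)
        _ = K := by rw [mul_comm K, ← mul_assoc, inv_mul_cancel₀ hcR.ne', one_mul]
    have h4 : ∫ y in ball y₀ R, ‖w k t y‖ ^ 2 ≤ R * K := (inv_mul_le_iff₀ hR).1 h3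
    linarith [mul_comm R K]
  -- ### the blow-downs `V_k = w_k(· - T_k) = c_k v(t₁ + c_k² ·, x₀ + c_k ·)`
  set V : ℕ → ℝ → EuclideanSpace ℝ (Fin 3) → EuclideanSpace ℝ (Fin 3) :=
    fun k => (c k) • stPull (c k ^ 2) (c k) t₁ x₀ v with hV
  have hcT : ∀ k (s : ℝ), c k ^ 2 * (s - T k) = t₁ + c k ^ 2 * s := fun k s => by
    have hc0 : c k ≠ 0 := (hcpos k).ne'
    simp only [hT]
    field_simp
    ring
  have hVw : ∀ k, (fun s y => w k (s - T k) y) = V k := by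
    intro k
    funext s y
    simp only [hw, hV, smul_stPull_apply, zero_add, hcT]
  have hVapply : ∀ k (s : ℝ) (y : EuclideanSpace ℝ (Fin 3)),
      V k s y = c k • v (t₁ + c k ^ 2 * s) (x₀ + c k • y) := fun k s y => by
    simp only [hV, smul_stPull_apply]
  have hVfun : ∀ k (s : ℝ), V k s = fun y => c k • v (t₁ + c k ^ 2 * s) (x₀ + c k • y) :=
    fun k s => funext (hVapply k s)
  have hVA : ∀ k, IsTypeIAncientMild C (V k) := fun k => by
    rw [← hVw k]; exact (hwA k).comp_sub_right (hT0 k).le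
  have hKV : ∀ k, ∀ t < 0, ∀ (y₀ : EuclideanSpace ℝ (Fin 3)) (R : ℝ), 0 < R →
      ∫ y in ball y₀ R, ‖V k t y‖ ^ 2 ≤ K * R := by
    intro k t ht y₀ R hR
    rw [← hVw k]
    exact hKw k (t - T k) (by linarith [hT0 k]) y₀ R hR
  -- ### the pressures
  have hq : ∀ k, ∃ q : ℝ → EuclideanSpace ℝ (Fin 3) → ℝ, IsSuitableWeakSolutionInBall 1 0 (V k) q ∧
      ∫⁻ z in parabolicCylinder 1 (0 : ℝ × EuclideanSpace ℝ (Fin 3)), ‖q z.1 z.2‖ₑ ^ (3 / 2 : ℝ) ≤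
        ENNReal.ofReal D₀ := by
    intro k
    obtain ⟨q, h1, h2⟩ := hPress (w k) (hwA k) (hKw k) (T k) ⟨hT0 k, hT1 k⟩
    rw [hVw k] at h1
    exact ⟨q, h1, h2⟩
  choose q hball hqD using hq
  -- ### the hypotheses of Lemma 2.2
  have hsup : (⨆ k, eLpNorm (uncurry (V k)) 3
        (volume.restrict (parabolicCylinder 1 (0 : ℝ × EuclideanSpace ℝ (Fin 3)))) +
      eLpNorm (uncurry (q k)) (3 / 2)
        (volume.restrict (parabolicCylinder 1 (0 : ℝ × EuclideanSpace ℝ (Fin 3))))) < ∞ := by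
    have hbound : ∀ k, eLpNorm (uncurry (V k)) 3
          (volume.restrict (parabolicCylinder 1 (0 : ℝ × EuclideanSpace ℝ (Fin 3)))) +
        eLpNorm (uncurry (q k)) (3 / 2)
          (volume.restrict (parabolicCylinder 1 (0 : ℝ × EuclideanSpace ℝ (Fin 3)))) ≤
        ENNReal.ofReal (2 * C * K) ^ (1 / 3 : ℝ) + ENNReal.ofReal D₀ ^ (2 / 3 : ℝ) := fun k =>
      eLpNorm_three_add_le (hcubic (V k) (hVA k) (hKV k)) (hqD k)
    refine lt_of_le_of_lt (iSup_le hbound) ?_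
    exact ENNReal.add_lt_top.2 ⟨ENNReal.rpow_lt_top_of_nonneg (by norm_num) ENNReal.ofReal_ne_top,
      ENNReal.rpow_lt_top_of_nonneg (by norm_num) ENNReal.ofReal_ne_top⟩
  -- ### Lemma 2.2 and persistence of singularities
  obtain ⟨u, p, σ, hσ, hlim⟩ := SuitableCompactness_holds V q hball hsup
  have hsing : IsBackwardSingularPoint u 0 := by
    refine PersistenceOfSingularities_holds (fun j => V (σ j)) (fun j => q (σ j)) u p
      (fun j => hball (σ j)) ?_ ?_ ?_
    · refine lt_of_le_of_lt (iSup_le fun j => ?_) hsup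
      exact le_iSup (fun k => eLpNorm (uncurry (V k)) 3
        (volume.restrict (parabolicCylinder 1 (0 : ℝ × EuclideanSpace ℝ (Fin 3)))) +
        eLpNorm (uncurry (q k)) (3 / 2)
        (volume.restrict (parabolicCylinder 1 (0 : ℝ × EuclideanSpace ℝ (Fin 3))))) (σ j)
    · intro R hR
      obtain ⟨h1, -, h3, h4⟩ := hlim R hR
      exact ⟨h1, h3, h4⟩
    · intro R hR
      have ht := tendsto_eLpNorm_top_zoom_atTop (u := v) (z₁ := z₁) hρ0 (fun j => hcpos (σ j))
        (hctop.comp hσ.tendsto_atTop) hN hR.1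
      exact ht.limsup_eq
  -- ### the `C¹_loc` limit in `A_C` along a further subsequence
  obtain ⟨φ, hφ, W, hW, hpt, -, hlu, -⟩ :=
    exists_tendsto_of_isTypeIAncientMild_seq C (w := fun j => V (σ j)) (fun j => hVA (σ j))
  -- ### the identification `u = W` a.e. on `Q(0, 1/2)`
  have h12 : (1 / 2 : ℝ) ∈ Ioo (0 : ℝ) 1 := ⟨by norm_num, by norm_num⟩
  obtain ⟨-, hL3u, hconv, -⟩ := hlim (1 / 2) h12
  set Q₂ : Set (ℝ × EuclideanSpace ℝ (Fin 3)) := parabolicCylinder (1 / 2) (0 : ℝ × EuclideanSpace ℝ (Fin 3))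
    with hQ₂
  have hQm : MeasurableSet Q₂ := (isOpen_parabolicCylinder _ _).measurableSet
  have hQ₂sub : Q₂ ⊆ Ioo (-1 : ℝ) 0 ×ˢ (univ : Set (EuclideanSpace ℝ (Fin 3))) := by
    intro z hz
    rw [hQ₂, mem_parabolicCylinder] at hz
    refine ⟨⟨?_, ?_⟩, mem_univ _⟩
    · have := hz.1.1; simp at this; linarith
    · have := hz.1.2; simpa using this
  have hVm : ∀ j, AEStronglyMeasurable (uncurry (V (σ (φ j)))) (volume.restrict Q₂) := fun j =>
    ((hVA (σ (φ j))).aestronglyMeasurable_uncurry (s := -1) le_rfl).mono_measure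
      (Measure.restrict_mono hQ₂sub le_rfl)
  have hum : AEStronglyMeasurable (uncurry u) (volume.restrict Q₂) := hL3u.1
  have hconvφ : Tendsto (fun j => eLpNorm (uncurry (V (σ (φ j))) - uncurry u) 3 (volume.restrict Q₂))
      atTop (𝓝 0) := hconv.comp hφ.tendsto_atTop
  have hmeas : TendstoInMeasure (volume.restrict Q₂) (fun j => uncurry (V (σ (φ j)))) atTop (uncurry u) :=
    tendstoInMeasure_of_tendsto_eLpNorm (by norm_num) hVm hum hconvφ
  obtain ⟨ns, hns, hae⟩ := hmeas.exists_seq_tendsto_ae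
  have hUW : uncurry u =ᵐ[volume.restrict Q₂] uncurry W := by
    filter_upwards [hae, ae_restrict_mem hQm] with z hz hzQ
    obtain ⟨s, y⟩ := z
    have hs : s < 0 := by have := (mem_parabolicCylinder.1 hzQ).1.2; simpa using this
    have h2 : Tendsto (fun i => V (σ (φ (ns i))) s y) atTop (𝓝 (W s y)) :=
      (hpt s hs y).comp hns.tendsto_atTop
    exact tendsto_nhds_unique hz h2
  -- ### the output
  refine ⟨t₁, x₀, fun j => c (σ (φ j)), u, W, ht₁0, fun j => hcpos _,
    hctop.comp (hσ.tendsto_atTop.comp hφ.tendsto_atTop), hW, ?_, ?_, hsing, hUW⟩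
  · intro s hs y
    have h := hpt s hs y
    simpa only [hVapply] using h
  · intro s hs
    have h := hlu s hs
    simpa only [hVfun] using h

end Summit.NavierStokesRegularity.NavierStokesRegularity.Theorems.ForcedSymmetry.BlowDownCensus

end
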